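import Literature.AlgebraicTopology.FundamentalGroupoid.GeneralPositionChart
import Literature.AlgebraicTopology.FundamentalGroup.VanKampenKernel
import Literature.Topology.FourManifolds.RegularSublevelSet
import Mathlib.Geometry.Manifold.ContMDiff.NormedSpace
import HarnessLib

/-!
# General position on a manifold: pushing paths and discs off a thin compact set

Topic `Literature/AlgebraicTopology/FundamentalGroupoid`.  The chart-by-chart globalisation of
`Literature.AlgebraicTopology.FundamentalGroupoid.exists_homotopyRel_forall_notMem`
(`GeneralPositionChart.lean`).  Let `M` be a Hausdorff `C^∞` manifold over a model with
corners `J` on the finite-dimensional real normed space `E` (boundary allowed), and `C ⊆ M` a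
compact set of interior points which is *thin for `k`-dimensional general position*: covered by
countably many images `G j '' O j` of maps `G j : ℝᵈ ⊇ O j → M` that are `C¹` on the open sets
`O j`, with `d + k < dim E`.  Then (`exists_homotopyRel_forall_notMem_of_isCompact`) every
continuous map `f : K → M` from a compact uniform retract `K` of a `k`-dimensional real normed
space is homotopic, relative to a closed `Z ⊆ K` with `f '' Z ∩ C = ∅` and through maps avoiding
any closed `C₀` avoided by `f`, to a map avoiding `C`: cover `C` by finitely many chart balls
(`Literature.Topology.FourManifolds.interiorExtChart`) and push `f` off the pieces one at a
time, protecting the pieces already cleared.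

Consequences in the form used for fundamental groups (Hirsch, *Differential Topology* (1976),
Ch. 3, Thm. 2.5 and its standard corollaries: a compact union of submanifolds of codimension
`≥ 2` does not disconnect and does not obstruct loops, one of codimension `≥ 3` does not obstruct
null-homotopies):

* `exists_path_forall_notMem_homotopicWithin` (`k = 1`): a path inside an open `U` with ends off
  `C` is homotopic within `U`, rel ends, to a path avoiding `C`, when `d + 1 < dim E`;
* `exists_homotopy_forall_notMem` (`k = 2`): a null-homotopy inside `U` of a loop avoiding `C`
  can be replaced by a null-homotopy inside `U ∖ C` of the same loop, when `d + 2 < dim E`.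

Everything is proved; no definitions.

## References

* M. W. Hirsch, *Differential Topology*, GTM 33, Springer (1976), Ch. 3, Thm. 2.5. [HirschDT1976]
* A. Kosinski, *Differential Manifolds*, Academic Press (1993), VI.2.
-/

noncomputable section

open Set Metric Topology unitInterval Function Module Filter
open scoped Manifold ContDiff Pointwise

namespace Literature.AlgebraicTopology.FundamentalGroupoid

/-! ### The one-chart lemma for a ball of any radius -/

section Rescale

variable {E : Type*} [NormedAddCommGroup E] [NormedSpace ℝ E] [FiniteDimensional ℝ E]
  {W : Type*} [NormedAddCommGroup W] [NormedSpace ℝ W] [FiniteDimensional ℝ W]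
  {K : Type*} [UniformSpace K] [CompactSpace K]
  {M : Type*} [TopologicalSpace M] [T2Space M]

/-- `Literature.AlgebraicTopology.FundamentalGroupoid.exists_homotopyRel_forall_notMem` for a
chart ball of arbitrary radius `r`: `closedBall c (3r) ⊆ e.target`, `e '' C ⊆ closedBall c r`
(rescale the chart by `r⁻¹`). [folklore] -/
theorem exists_homotopyRel_forall_notMem_of_ball {ι' : K → W} {π : W → K} (hι : Continuous ι')
    (hπ : UniformContinuous π) (hπι : ∀ x, π (ι' x) = x)
    (e : OpenPartialHomeomorph M E) {c : E} {r : ℝ} (hr : 0 < r)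
    (hrt : closedBall c (3 * r) ⊆ e.target)
    {ι : Type*} [Countable ι] {d : ℕ} (O : ι → Set (Fin d → ℝ)) (G : ι → (Fin d → ℝ) → E)
    (hO : ∀ j, IsOpen (O j)) (hG : ∀ j, ContDiffOn ℝ 1 (G j) (O j))
    (hdim : d + finrank ℝ W < finrank ℝ E)
    {C : Set M} (hCs : C ⊆ e.source) (hCc : IsClosed C) (hCr : ∀ z ∈ C, e z ∈ closedBall c r)
    (hCG : e '' C ⊆ ⋃ j, G j '' O j)
    {C₀ : Set M} (hC₀ : IsClosed C₀)
    (f : C(K, M)) (hf₀ : ∀ x, f x ∉ C₀) {Z : Set K} (hZ : IsClosed Z) (hfZ : ∀ z ∈ Z, f z ∉ C) :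
    ∃ g : C(K, M), (∀ x, g x ∉ C) ∧ ∃ F : f.HomotopyRel g Z, ∀ p, F p ∉ C₀ := by
  have hr' : (r⁻¹ : ℝ) ≠ 0 := inv_ne_zero hr.ne'
  set L : E ≃ₜ E := Homeomorph.smulOfNeZero (r⁻¹ : ℝ) hr' with hL
  set e' : OpenPartialHomeomorph M E := e.transHomeomorph L with he'
  have he'app : ∀ z, e' z = r⁻¹ • e z := fun z => rfl
  have he'src : e'.source = e.source := rfl
  have he'tgt : ∀ y, y ∈ e'.target ↔ r • y ∈ e.target := by
    intro y
    change L.symm y ∈ e.target ↔ _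
    rw [hL, Homeomorph.smulOfNeZero_symm_apply, inv_inv]
  -- distances scale
  have hdist : ∀ y z : E, dist (r⁻¹ • y) (r⁻¹ • z) = r⁻¹ * dist y z := fun y z => by
    rw [dist_smul₀, Real.norm_eq_abs, abs_of_pos (inv_pos.2 hr)]
  refine exists_homotopyRel_forall_notMem hι hπ hπι e' (c := r⁻¹ • c) (R := 1) ?_
    O (fun j u => r⁻¹ • G j u) hO (fun j => (hG j).const_smul _) hdim
    (by rw [he'src]; exact hCs) hCc ?_ ?_ hC₀ f hf₀ hZ hfZ
  · intro y hy
    rw [he'tgt]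
    apply hrt
    rw [mem_closedBall] at hy ⊢
    have : dist (r • y) c = r * dist y (r⁻¹ • c) := by
      conv_lhs => rw [show c = r • (r⁻¹ • c) by rw [smul_smul, mul_inv_cancel₀ hr.ne', one_smul]]
      rw [dist_smul₀, Real.norm_eq_abs, abs_of_pos hr]
    rw [this]
    nlinarith
  · intro z hz
    rw [he'app, mem_closedBall, hdist]
    have := hCr z hz
    rw [mem_closedBall] at this
    calc r⁻¹ * dist (e z) c ≤ r⁻¹ * r := by gcongr
      _ = 1 := inv_mul_cancel₀ hr.ne'
  · rintro _ ⟨z, hz, rfl⟩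
    obtain ⟨j, u, hu, hju⟩ := mem_iUnion.1 (hCG ⟨z, hz, rfl⟩) |>.imp fun j h => h
    exact mem_iUnion.2 ⟨j, u, hu, by rw [he'app, ← hju]⟩

end Rescale

/-! ### Uniform retracts: the interval and the square -/

/-- `[0,1]` is a uniform retract of `ℝ` (`projIcc`), of dimension `1`. [folklore] -/
theorem retract_unitInterval' :
    Continuous (fun x : I => (x : ℝ)) ∧ UniformContinuous (projIcc (0 : ℝ) 1 zero_le_one) ∧
      (∀ x : I, projIcc (0 : ℝ) 1 zero_le_one (x : ℝ) = x) ∧ finrank ℝ ℝ = 1 :=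
  ⟨continuous_subtype_val, (LipschitzWith.projIcc _).uniformContinuous, fun x => projIcc_val _ x,
    Module.finrank_self ℝ⟩

/-- `[0,1]²` is a uniform retract of `ℝ²`, of dimension `2`. [folklore] -/
theorem retract_unitSquare' :
    Continuous (fun x : I × I => ((x.1 : ℝ), (x.2 : ℝ))) ∧
      UniformContinuous (fun y : ℝ × ℝ =>
        (projIcc (0 : ℝ) 1 zero_le_one y.1, projIcc (0 : ℝ) 1 zero_le_one y.2)) ∧
      (∀ x : I × I, (projIcc (0 : ℝ) 1 zero_le_one (x.1 : ℝ),
        projIcc (0 : ℝ) 1 zero_le_one (x.2 : ℝ)) = x) ∧ finrank ℝ (ℝ × ℝ) = 2 := by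
  refine ⟨by fun_prop, ?_, fun x => by simp only [projIcc_val], by simp⟩
  exact ((LipschitzWith.projIcc _).uniformContinuous.comp uniformContinuous_fst).prodMk
    ((LipschitzWith.projIcc _).uniformContinuous.comp uniformContinuous_snd)

/-! ### Globalisation on a manifold -/

section Manifold

variable {E : Type*} [NormedAddCommGroup E] [NormedSpace ℝ E] [FiniteDimensional ℝ E]
  {H : Type*} [TopologicalSpace H] {J : ModelWithCorners ℝ E H}
  {M : Type*} [TopologicalSpace M] [ChartedSpace H M] [IsManifold J ∞ M] [T2Space M]
  {W : Type*} [NormedAddCommGroup W] [NormedSpace ℝ W] [FiniteDimensional ℝ W]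
  {K : Type*} [UniformSpace K] [CompactSpace K]

open Literature.Topology.FourManifolds in
/-- **General position off a thin compact set of interior points.**  Let `C ⊆ M` be compact,
consisting of interior points, and covered by countably many images `G j '' O j` of maps
`C¹` on open subsets `O j ⊆ ℝᵈ`; let `K` be a compact uniform retract of a real normed space `W`
with `d + dim W < dim E`; let `f : K → M` be continuous avoiding the closed set `C₀`, with
`f '' Z ∩ C = ∅` for the closed set `Z ⊆ K`.  Then `f` is homotopic rel `Z`, through maps
avoiding `C₀`, to a map avoiding `C` (cover `C` by finitely many chart balls and apply the
one-chart lemma to each, protecting what has been cleared). [folklore] -/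
theorem exists_homotopyRel_forall_notMem_of_isCompact {ι' : K → W} {π : W → K}
    (hι : Continuous ι') (hπ : UniformContinuous π) (hπι : ∀ x, π (ι' x) = x)
    {ι : Type*} [Countable ι] {d : ℕ} (O : ι → Set (Fin d → ℝ)) (G : ι → (Fin d → ℝ) → M)
    (hO : ∀ j, IsOpen (O j)) (hG : ∀ j, ContMDiffOn 𝓘(ℝ, Fin d → ℝ) J 1 (G j) (O j))
    (hdim : d + finrank ℝ W < finrank ℝ E)
    {C : Set M} (hC : IsCompact C) (hCint : ∀ x ∈ C, J.IsInteriorPoint x)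
    (hCG : C ⊆ ⋃ j, G j '' O j)
    {C₀ : Set M} (hC₀ : IsClosed C₀)
    (f : C(K, M)) (hf₀ : ∀ x, f x ∉ C₀) {Z : Set K} (hZ : IsClosed Z) (hfZ : ∀ z ∈ Z, f z ∉ C) :
    ∃ g : C(K, M), (∀ x, g x ∉ C) ∧ ∃ F : f.HomotopyRel g Z, ∀ p, F p ∉ C₀ := by
  classical
  -- charts at the points of `C`
  set e : M → OpenPartialHomeomorph M E := fun x => interiorExtChart J x with he_def
  have he : ∀ x, ContMDiffOn J 𝓘(ℝ, E) 1 (e x) (e x).source := fun x =>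
    (contMDiffOn_interiorExtChart J x).of_le (by exact_mod_cast le_top)
  have hsrc : ∀ x ∈ C, x ∈ (e x).source := fun x hx => mem_interiorExtChart_source_self (hCint x hx)
  -- radii
  have hrad : ∀ x, ∃ r : ℝ, 0 < r ∧ (x ∈ C → closedBall (e x x) (3 * r) ⊆ (e x).target) := by
    intro x
    by_cases hx : x ∈ C
    · have ht : (e x).target ∈ 𝓝 (e x x) :=
        (e x).open_target.mem_nhds ((e x).map_source (hsrc x hx))
      obtain ⟨ε, hε, hball⟩ := Metric.mem_nhds_iff.1 ht
      refine ⟨ε / 4, by positivity, fun _ => (closedBall_subset_ball ?_).trans hball⟩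
      linarith
    · exact ⟨1, one_pos, fun h => (hx h).elim⟩
  choose r hr hrt using hrad
  -- the open cover of `C` and a finite subcover
  set V : M → Set M := fun x => (e x).source ∩ (e x) ⁻¹' ball (e x x) (r x) with hV_def
  have hVo : ∀ x, IsOpen (V x) := fun x =>
    (e x).continuousOn.isOpen_inter_preimage (e x).open_source isOpen_ball
  have hVx : ∀ x ∈ C, V x ∈ 𝓝 x := fun x hx =>
    (hVo x).mem_nhds ⟨hsrc x hx, mem_ball_self (hr x)⟩
  obtain ⟨t, htC, hcover⟩ := hC.elim_nhds_subcover V hVx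
  -- the closed pieces
  set P : M → Set M := fun x => C ∩ (e x).symm '' closedBall (e x x) (r x) with hP_def
  have hballt : ∀ x ∈ C, closedBall (e x x) (r x) ⊆ (e x).target := fun x hx =>
    (closedBall_subset_closedBall (by linarith [hr x])).trans (hrt x hx)
  have hPc : ∀ x ∈ C, IsClosed (P x) := by
    intro x hx
    refine hC.isClosed.inter (IsCompact.isClosed ?_)
    exact (isCompact_closedBall _ _).image_of_continuousOn ((e x).continuousOn_symm.mono (hballt x hx))
  have hPs : ∀ x ∈ C, P x ⊆ (e x).source := by
    rintro x hx z ⟨-, y, hy, rfl⟩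
    exact (e x).map_target (hballt x hx hy)
  have hPr : ∀ x ∈ C, ∀ z ∈ P x, e x z ∈ closedBall (e x x) (r x) := by
    rintro x hx z ⟨-, y, hy, rfl⟩
    rw [(e x).right_inv (hballt x hx hy)]; exact hy
  have hVP : ∀ x ∈ C, V x ∩ C ⊆ P x := by
    rintro x hx z ⟨⟨hzs, hzb⟩, hzC⟩
    exact ⟨hzC, e x z, ball_subset_closedBall hzb, (e x).left_inv hzs⟩
  have hCP : C ⊆ ⋃ x ∈ t, P x := by
    intro z hz
    obtain ⟨x, hxt, hzV⟩ := mem_iUnion₂.1 (hcover hz)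
    exact mem_iUnion₂.2 ⟨x, hxt, hVP x (htC x hxt) ⟨hzV, hz⟩⟩
  -- induction over the finite set of pieces
  have key : ∀ s : Finset M, (∀ x ∈ s, x ∈ C) →
      ∃ g : C(K, M), (∀ x ∈ s, ∀ y, g y ∉ P x) ∧ ∃ F : f.HomotopyRel g Z, ∀ p, F p ∉ C₀ := by
    intro s
    induction s using Finset.induction_on with
    | empty =>
      intro _
      exact ⟨f, fun x hx => (Finset.notMem_empty x hx).elim, ContinuousMap.HomotopyRel.refl f Z,
        fun p => by simpa using hf₀ p.2⟩
    | insert a s has ih =>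
      intro hs
      have haC : a ∈ C := hs a (Finset.mem_insert_self a s)
      obtain ⟨g, hgP, F, hF⟩ := ih fun x hx => hs x (Finset.mem_insert_of_mem hx)
      -- the pieces of `C` in the chart at `a`
      set O' : ι → Set (Fin d → ℝ) := fun j => O j ∩ G j ⁻¹' (e a).source with hO'_def
      set G' : ι → (Fin d → ℝ) → E := fun j u => e a (G j u) with hG'_def
      have hO' : ∀ j, IsOpen (O' j) := fun j =>
        (hG j).continuousOn.isOpen_inter_preimage (hO j) (e a).open_source
      have hG' : ∀ j, ContDiffOn ℝ 1 (G' j) (O' j) := by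
        intro j
        rw [← contMDiffOn_iff_contDiffOn]
        exact (he a).comp ((hG j).mono inter_subset_left) fun u hu => hu.2
      have hCG' : e a '' P a ⊆ ⋃ j, G' j '' O' j := by
        rintro _ ⟨z, hz, rfl⟩
        obtain ⟨j, hj⟩ := mem_iUnion.1 (hCG hz.1)
        obtain ⟨u, hu, rfl⟩ := hj
        exact mem_iUnion.2 ⟨j, u, ⟨hu, hPs a haC hz⟩, rfl⟩
      -- the protected set
      set C₀' : Set M := C₀ ∪ ⋃ x ∈ s, P x with hC₀'_def
      have hC₀' : IsClosed C₀' := by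
        refine hC₀.union (isClosed_biUnion_finset fun x hx => hPc x ?_)
        exact hs x (Finset.mem_insert_of_mem hx)
      have hg₀ : ∀ y, g y ∉ C₀' := by
        intro y hy
        rcases hy with hy | hy
        · exact hF (1, y) (by rw [F.apply_one]; exact hy)
        · obtain ⟨x, hx, hy⟩ := mem_iUnion₂.1 hy
          exact hgP x hx y hy
      have hgZ : ∀ z ∈ Z, g z ∉ P a := fun z hz h =>
        hfZ z hz (by rw [F.fst_eq_snd hz]; exact h.1)
      obtain ⟨g', hg'P, F', hF'⟩ := exists_homotopyRel_forall_notMem_of_ball hι hπ hπι (e a)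
        (hr a) (hrt a haC) O' G' hO' hG' hdim (hPs a haC) (hPc a haC) (hPr a haC) hCG' hC₀' g
        hg₀ hZ hgZ
      refine ⟨g', fun x hx y => ?_, F.trans F', fun p => ?_⟩
      · rcases Finset.mem_insert.1 hx with rfl | hx
        · exact hg'P y
        · intro hy
          refine hF' (1, y) ?_
          rw [F'.apply_one]
          exact Or.inr (mem_iUnion₂.2 ⟨x, hx, hy⟩)
      · rw [ContinuousMap.HomotopyRel.trans_apply]
        split_ifs
        · exact hF _
        · exact fun h => hF' _ (Or.inl h)
  obtain ⟨g, hgP, F, hF⟩ := key t htC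
  refine ⟨g, fun y hy => ?_, F, hF⟩
  obtain ⟨x, hxt, hyP⟩ := mem_iUnion₂.1 (hCP hy)
  exact hgP x hxt y hyP

open Literature.AlgebraicTopology.FundamentalGroup.VanKampen in
/-- **Paths can be pushed off a thin compact set (`k = 1`).**  If `C ⊆ M` is a compact set of
interior points covered by countably many `C¹` images of open subsets of `ℝᵈ` with
`d + 1 < dim E`, then every path inside an open set `U` whose end points avoid `C` is homotopic
within `U`, rel end points, to a path avoiding `C` (general position for curves, Hirsch Ch. 3,
Thm. 2.5: a compact union of submanifolds of codimension `≥ 2` does not obstruct paths).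
[folklore] -/
theorem exists_path_forall_notMem_homotopicWithin
    {ι : Type*} [Countable ι] {d : ℕ} (O : ι → Set (Fin d → ℝ)) (G : ι → (Fin d → ℝ) → M)
    (hO : ∀ j, IsOpen (O j)) (hG : ∀ j, ContMDiffOn 𝓘(ℝ, Fin d → ℝ) J 1 (G j) (O j))
    (hdim : d + 1 < finrank ℝ E)
    {C : Set M} (hC : IsCompact C) (hCint : ∀ x ∈ C, J.IsInteriorPoint x)
    (hCG : C ⊆ ⋃ j, G j '' O j) {U : Set M} (hU : IsOpen U)
    {x y : M} (γ : Path x y) (hγ : ∀ t, γ t ∈ U) (hx : x ∉ C) (hy : y ∉ C) :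
    ∃ γ' : Path x y, (∀ t, γ' t ∉ C) ∧ HomotopicWithin U γ γ' := by
  obtain ⟨hι, hπ, hπι, h1⟩ := retract_unitInterval'
  have hZ : IsClosed ({0, 1} : Set I) := (toFinite _).isClosed
  obtain ⟨g, hgC, F, hF⟩ := exists_homotopyRel_forall_notMem_of_isCompact hι hπ hπι O G hO hG
    (h1.symm ▸ hdim) hC hCint hCG hU.isClosed_compl γ.toContinuousMap (fun t h => h (hγ t)) hZ
    (by
      rintro z (rfl | rfl)
      · simpa using hx
      · simpa using hy)
  have hg0 : g 0 = x := by
    have := F.fst_eq_snd (show (0 : I) ∈ ({0, 1} : Set I) by simp)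
    simpa using this.symm
  have hg1 : g 1 = y := by
    have := F.fst_eq_snd (show (1 : I) ∈ ({0, 1} : Set I) by simp)
    simpa using this.symm
  let γ' : Path x y := ⟨g, hg0, hg1⟩
  exact ⟨γ', fun t => hgC t, ⟨F, fun p => not_notMem.1 (hF p)⟩⟩

/-- **Null-homotopies can be pushed off a thin compact set (`k = 2`).**  If `C ⊆ M` is a
compact set of interior points covered by countably many `C¹` images of open subsets of `ℝᵈ`
with `d + 2 < dim E`, then a null-homotopy inside an open set `U` of a loop avoiding `C` can be
replaced by a null-homotopy of the same loop inside `U ∖ C` (general position for discs,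
Hirsch Ch. 3, Thm. 2.5: a compact union of submanifolds of codimension `≥ 3` does not obstruct
null-homotopies). [folklore] -/
theorem exists_homotopy_forall_notMem
    {ι : Type*} [Countable ι] {d : ℕ} (O : ι → Set (Fin d → ℝ)) (G : ι → (Fin d → ℝ) → M)
    (hO : ∀ j, IsOpen (O j)) (hG : ∀ j, ContMDiffOn 𝓘(ℝ, Fin d → ℝ) J 1 (G j) (O j))
    (hdim : d + 2 < finrank ℝ E)
    {C : Set M} (hC : IsCompact C) (hCint : ∀ x ∈ C, J.IsInteriorPoint x)
    (hCG : C ⊆ ⋃ j, G j '' O j) {U : Set M} (hU : IsOpen U)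
    {a : M} (γ : Path a a) (F : γ.Homotopy (Path.refl a)) (hγ : ∀ t, γ t ∉ C)
    (hF : ∀ st, F st ∈ U) :
    ∃ G' : γ.Homotopy (Path.refl a), ∀ st, G' st ∈ U ∧ G' st ∉ C := by
  obtain ⟨hι, hπ, hπι, h2⟩ := retract_unitSquare'
  -- the boundary of the square
  let Z : Set (I × I) := {z | z.1 = 0} ∪ ({z | z.1 = 1} ∪ ({z | z.2 = 0} ∪ {z | z.2 = 1}))
  have hZ : IsClosed Z :=
    (isClosed_eq continuous_fst continuous_const).union
      ((isClosed_eq continuous_fst continuous_const).union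
        ((isClosed_eq continuous_snd continuous_const).union
          (isClosed_eq continuous_snd continuous_const)))
  have ha : a ∉ C := by simpa using hγ 0
  have hFZ : ∀ z ∈ Z, F.toContinuousMap z ∉ C := by
    rintro ⟨s, t⟩ hz
    change F (s, t) ∉ C
    rcases hz with h | h | h | h <;> simp only [mem_setOf_eq] at h <;> subst h
    · rw [F.apply_zero]; exact hγ t
    · rw [F.apply_one]; simpa using ha
    · rw [F.eq_fst s (by simp)]; exact hγ 0
    · rw [F.eq_fst s (by simp)]; exact hγ 1
  obtain ⟨g, hgC, Φ, hΦ⟩ := exists_homotopyRel_forall_notMem_of_isCompact hι hπ hπι O G hO hG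
    (h2.symm ▸ hdim) hC hCint hCG hU.isClosed_compl F.toContinuousMap (fun st h => h (hF st)) hZ
    hFZ
  have hgF : ∀ z ∈ Z, g z = F z := fun z hz => (Φ.fst_eq_snd hz).symm
  have hgU : ∀ st, g st ∈ U := fun st => by
    have := hΦ (1, st)
    rw [Φ.apply_one] at this
    exact not_notMem.1 this
  refine ⟨{ toFun := g
            continuous_toFun := g.continuous
            map_zero_left := fun t => ?_
            map_one_left := fun t => ?_
            prop' := fun s t ht => ?_ }, fun st => ⟨hgU st, hgC st⟩⟩
  · rw [hgF (0, t) (Or.inl rfl)]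
    exact F.apply_zero t
  · rw [hgF (1, t) (Or.inr (Or.inl rfl))]
    exact F.apply_one t
  · change g (s, t) = γ t
    have hst : (s, t) ∈ Z := by
      rcases ht with h | h
      · exact Or.inr (Or.inr (Or.inl h))
      · exact Or.inr (Or.inr (Or.inr h))
    rw [hgF (s, t) hst]
    exact F.eq_fst s ht

end Manifold

end Literature.AlgebraicTopology.FundamentalGroupoid
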